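/-
COR-CM (cell pub-hodgecm2, stage 2 of the Hodge ladder) — a count-neutral KERNEL CALIBRATION of the displayed leaf B01-S
`Universe.FaceSupply` (`CorCM/B01/FaceInputsSplit.lean` :50, p252201) on the model universe of record: SUPPLY IS MONOTONE IN
THE LEVEL, hence B01-S is equivalent to two INDEPENDENT one-type supplies.  Seat prover-pub-hodgecm2-b07-g31-0 (binder prover
b07, gen 31; claim UISO-LEVEL, HOME/lit/LIT-STATUS.md 2026-08-21T07:35Z).  Theorems only: no definition, no named fact, nothing
asserted; nothing under `CorCM/B01/` is edited (its decls are imported BY NAME); `Interfaces.lean` (C1) untouched.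
-/
import Summits.HodgeConjecture.CorCM.B01.LevelCovering
import Summits.HodgeConjecture.CorCM.B01.FaceInputsSplit
import Literature.AlgebraicGeometry.ShimuraVarieties.UnitaryBallHolomorphicLift
import HarnessLib

/-!
# B01-S on the model universe: supply is monotone in the level; `FaceSupply` ⇔ two slotwise supplies

Let `U = Model.picardCMUniverse hHD hI h₁ h₃` (equivalently `Model.universeOf hHD hI hU h₃`) be the model universe of COR-CM and
`V` a hermitian 3-space over a CM field `L` with `2 < [L:ℚ]` (every face context: `6 ≤ [F:ℚ]`), so that every Picard code
`pmsCode L ι₁ V Γ` is anisotropic and `U.pms L ι₁ V Γ` is a genuine compact ball quotient `X_Γ` (`Var.ballDatum`).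

1. `pull_baseChange_injOn_hodge_F_one` (generic, two ball quotient surfaces): for a morphism `f : X' ⟶ X` lying over the
   uniformisations (`f(ℂ) ∘ unif' = unif` on the cone) and Sylvester frames of the same matrix, the complexified pull-back
   `(f^* ⊗ ℂ)` is INJECTIVE on `F¹H¹(X)`.  Proof: the holomorphic lift to the ball `classLift : ℂ ⊗ H¹(X) → (𝔹² → ℂ²)`
   (`UnitaryBallHolomorphicLift`, Borel §5.14) is natural under the covering (`classLift_pull`) and non-zero on non-zero
   classes of `F¹H¹` (`classLift_ne_zero`: a holomorphic one-form with vanishing lift to the ball is zero).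
2. `Model.exists_mor_pms_pullC_injOn` — for levels `Γ' ≤ Γ` (in `GL₃(L)`) the level covering `g : U.pms L ι₁ V Γ' ⟶ U.pms L ι₁ V Γ`
   of `Model.exists_levelCover` / `Model.exists_mor_pms_map_unif` has `U.pullC g 1` injective on `F¹H¹(P_Γ)`.
3. `Model.exists_mor_pms_uiso_mono` — **supply is monotone in the level**: that `g` maps `U_Ψ(Γ)_σ` into `U_Ψ(Γ')_σ`
   (`Universe.pullC_mem_Uiso`) injectively (`U_Ψ ⊆ F¹H¹`, `Universe.Uiso_le_F_one`); `Model.exists_mem_uiso_ne_zero_of_le`: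
   a non-zero class of `U_Ψ(Γ)_σ` gives one of `U_Ψ(Γ')_σ` for every `Γ' ≤ Γ`.
4. `Model.faceSupply_iff_slotwise` — **B01-S ⇔ two independent one-type supplies**: definition-free,
   `U.FaceSupply ↔ ∀ face data, (∃ Γ₀ ω₀ ∈ U_{Ψ₀}(Γ₀)_{ι₁}, ω₀ ≠ 0) ∧ (∃ Γ₁ ω₁ ∈ U_{Ψ₁}(Γ₁)_{ι₁}, ω₁ ≠ 0)` (common refinement
   `Γ₀ ⊓ Γ₁`, `Level.inf`); and `Model.faceSupply_iff_cofinal`: the two classes may be demanded at EVERY level below some `Γ`.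

Reading.  A discharger of B01-S (one-type theta-lift non-vanishing of the stage-1 `hΘ` kind, or «the simple CM abelian variety
`A_{(K₁,Φ₁)}` of the primitive core of `Ψᵢ` is an isogeny factor of `Alb(P_Γ)` for SOME `Γ`», one type at a time) owes no
common-level bookkeeping: the two supplies may live at unrelated levels.  Nothing displayed changes — whether B01-S is re-cut in
this shape is the call of the single owner of `CorCM/B01/` (pub-hodgecm2-own-b01); this file proves the equivalence only.

References: A. Borel, *Automorphic forms on SL₂(ℝ)* (1997) §5.13–5.14 (forms on the group vs. forms on the quotient);
C. Voisin, *Hodge Theory and Complex Algebraic Geometry I* (2002) §7.1.1 Cor. 7.6, §7.3.2 (holomorphic forms = `F¹H¹` in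
degree one; pull-backs are morphisms of Hodge structures); N. Bergeron, J. Millson, C. Moeglin, Acta Math. 216 (2016),
Introduction §1.1 (the congruence tower of compact ball quotients).
-/

noncomputable section

open scoped TensorProduct Matrix
open NumberField CategoryTheory
open Literature.AlgebraicGeometry.Motives
open Literature.AlgebraicGeometry.ShimuraVarieties
open Literature.AlgebraicGeometry.HodgeTheory

namespace Summit.HodgeConjecture.CorCM

/-! ## §1  Pull-back along a covering of ball quotient surfaces is injective on `F¹H¹` -/

/-- **Pull-back along a morphism of compact ball quotient surfaces lying over the uniformisations is injective on
`F¹H¹`.**  `D, D'` ball data of `X, X'` with Sylvester frames of the same matrix, `f : X' ⟶ X` with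
`f(ℂ) (unif' v) = unif v` on the cone of `D'`: if `c, c' ∈ F¹H¹(X)` have the same pull-back then `c = c'` — their
difference has vanishing holomorphic lift to the ball (`classLift_pull`: the lift of `f^*ω` computed on `X'` is the lift
of `ω`) and a class of `F¹H¹` with vanishing lift is zero (`classLift_ne_zero`).
[cite: Borel1997, §5.13–5.14] [cite: VoisinHodgeI2002, §7.1.1 Cor. 7.6 and §7.3.2] -/
theorem pull_baseChange_injOn_hodge_F_one {X X' : SchemeOver ℂ} (D : UnitaryBallUniformisationDatum 2 X)
    (D' : UnitaryBallUniformisationDatum 2 X') (𝔣 : D.SylvesterFrame) (𝔣' : D'.SylvesterFrame)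
    (hHD : exists_isReal_hodgeModel) (hI : hodgePQ_independent_of_hodgeModel) (f : X' ⟶ X) (hT : 𝔣'.t = 𝔣.t)
    (hf : ∀ v ∈ D'.cone, AlgPoints.map f (D'.unif v) = D.unif v) :
    Set.InjOn ((BettiUniverse.pull f 1).baseChange ℂ) ((BettiUniverse.hodge hHD D.isSmoothProjective 1).F 1 : Set _) := by
  intro c hc c' hc' h
  rw [← sub_eq_zero]
  by_contra hne
  refine D.classLift_ne_zero hHD 𝔣 hI (Submodule.sub_mem _ hc hc') hne ?_
  rw [← D.classLift_pull hHD 𝔣 hI D' 𝔣' f hT hf (Submodule.sub_mem _ hc hc'), map_sub, h, sub_self, map_zero]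

/-- Pointed form: a NON-ZERO class of `F¹H¹(X)` has non-zero pull-back along such a morphism.
[cite: Borel1997, §5.13–5.14] [cite: VoisinHodgeI2002, §7.1.1 Cor. 7.6 and §7.3.2] -/
theorem pull_baseChange_ne_zero_of_mem_hodge_F_one {X X' : SchemeOver ℂ} (D : UnitaryBallUniformisationDatum 2 X)
    (D' : UnitaryBallUniformisationDatum 2 X') (𝔣 : D.SylvesterFrame) (𝔣' : D'.SylvesterFrame)
    (hHD : exists_isReal_hodgeModel) (hI : hodgePQ_independent_of_hodgeModel) (f : X' ⟶ X) (hT : 𝔣'.t = 𝔣.t)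
    (hf : ∀ v ∈ D'.cone, AlgPoints.map f (D'.unif v) = D.unif v)
    {c : ℂ ⊗[ℚ] bettiCohomology X 1} (hc : c ∈ (BettiUniverse.hodge hHD D.isSmoothProjective 1).F 1) (h0 : c ≠ 0) :
    (BettiUniverse.pull f 1).baseChange ℂ c ≠ 0 := by
  intro h
  apply h0
  refine pull_baseChange_injOn_hodge_F_one D D' 𝔣 𝔣' hHD hI f hT hf hc (Submodule.zero_mem _) ?_
  rw [h, map_zero]

namespace Model

open Literature.NumberTheory.Automorphic.PicardCM

/-! ## §2  The level covering of the model universe is injective on `F¹H¹` -/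

section Data

/-- **The level covering of the model universe is injective on `F¹H¹`.**  On `U = universeOf hHD hI hU h₃`, for levels
`Γ' ≤ Γ` (in `GL₃(L)`) of an anisotropic hermitian space there is a morphism `g : U.pms L ι₁ V Γ' ⟶ U.pms L ι₁ V Γ` lying over
the uniformisations (`Model.exists_levelCover`) whose complexified pull-back `U.pullC g 1` is injective on `F¹H¹(P_Γ)`
(`pull_baseChange_injOn_hodge_F_one`, the two ball data having the same Gram matrix, `Model.ballDatum_Hℂ_eq`, hence Sylvester
frames of the same matrix). [cite: Borel1997, §5.13–5.14] [cite: BergeronMillsonMoeglin2016Balls, Introduction §1.1] -/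
theorem universeOf_exists_mor_pms_pullC_injOn (hHD : exists_isReal_hodgeModel) (hI : hodgePQ_independent_of_hodgeModel)
    (hU : BallQuotientUniformisedDatum) (h₃ : CMAbelianVarietyRealised) {L : CMField} {ι₁ : L →+* ℂ} {V : HermSpace3 L ι₁}
    {Γ Γ' : Level V} (hle : Γ'.Γ ≤ Γ.Γ) (h : (pmsCode L ι₁ V Γ).IsAnisotropic) :
    ∃ g : (universeOf hHD hI hU h₃).Mor ((universeOf hHD hI hU h₃).pms L ι₁ V Γ') ((universeOf hHD hI hU h₃).pms L ι₁ V Γ),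
      (∀ v ∈ (Var.ballDatum hU h₃ (pmsCode L ι₁ V Γ') ((isAnisotropic_pmsCode_iff_of_level Γ Γ').2 h)).cone,
        AlgPoints.map g ((Var.ballDatum hU h₃ (pmsCode L ι₁ V Γ') ((isAnisotropic_pmsCode_iff_of_level Γ Γ').2 h)).unif v) =
          (Var.ballDatum hU h₃ (pmsCode L ι₁ V Γ) h).unif v) ∧
      Set.InjOn ((universeOf hHD hI hU h₃).pullC g 1)
        (((universeOf hHD hI hU h₃).hodge ((universeOf hHD hI hU h₃).pms L ι₁ V Γ) 1).F 1 : Set _) := by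
  have h' : (pmsCode L ι₁ V Γ').IsAnisotropic := (isAnisotropic_pmsCode_iff_of_level Γ Γ').2 h
  obtain ⟨g, hg⟩ := exists_levelCover hU h₃ hHD hle h' h
  -- Sylvester frames of the same matrix for the two ball data (same complex Gram matrix)
  obtain ⟨𝔣⟩ := (Var.ballDatum hU h₃ (pmsCode L ι₁ V Γ) h).nonempty_sylvesterFrame
  have hH : (Var.ballDatum hU h₃ (pmsCode L ι₁ V Γ') h').Hℂ = (Var.ballDatum hU h₃ (pmsCode L ι₁ V Γ) h).Hℂ :=
    ballDatum_Hℂ_eq hU h₃ Γ Γ' h' h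
  let 𝔣' : (Var.ballDatum hU h₃ (pmsCode L ι₁ V Γ') h').SylvesterFrame := ⟨𝔣.T, by rw [hH]; exact 𝔣.conjTranspose_mul_mul⟩
  refine ⟨g, hg, ?_⟩
  exact pull_baseChange_injOn_hodge_F_one (Var.ballDatum hU h₃ (pmsCode L ι₁ V Γ) h)
    (Var.ballDatum hU h₃ (pmsCode L ι₁ V Γ') h') 𝔣 𝔣' hHD hI g rfl hg

/-! ## §3  Supply is monotone in the level -/

/-- **`U_Ψ` along the level covering**: on `U = universeOf hHD hI hU h₃`, for levels `Γ' ≤ Γ` of an anisotropic hermitian space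
there is `g : U.pms L ι₁ V Γ' ⟶ U.pms L ι₁ V Γ` with `g^*(U_Ψ(Γ)_σ) ⊆ U_Ψ(Γ')_σ` for every CM pair `(K, Ψ)` and `σ`
(`Universe.pullC_mem_Uiso`, `Fact_pull_comp` of the model) and `g^*` injective on every `U_Ψ(Γ)_σ` (`U_Ψ ⊆ F¹H¹`,
`Universe.Uiso_le_F_one`, `Fact_pull_hodge` of the model). [cite: Borel1997, §5.13–5.14]
[cite: BergeronMillsonMoeglin2016Balls, Introduction §1.1] -/
theorem universeOf_exists_mor_pms_uiso_mono (hHD : exists_isReal_hodgeModel) (hI : hodgePQ_independent_of_hodgeModel)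
    (hU : BallQuotientUniformisedDatum) (h₃ : CMAbelianVarietyRealised) {L : CMField} {ι₁ : L →+* ℂ} {V : HermSpace3 L ι₁}
    {Γ Γ' : Level V} (hle : Γ'.Γ ≤ Γ.Γ) (h : (pmsCode L ι₁ V Γ).IsAnisotropic) :
    ∃ g : (universeOf hHD hI hU h₃).Mor ((universeOf hHD hI hU h₃).pms L ι₁ V Γ') ((universeOf hHD hI hU h₃).pms L ι₁ V Γ),
      ∀ (K : CMField) (Ψ : CMType K) (σ : K →+* ℂ),
        Submodule.map ((universeOf hHD hI hU h₃).pullC g 1) ((universeOf hHD hI hU h₃).Uiso Γ K Ψ σ) ≤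
            (universeOf hHD hI hU h₃).Uiso Γ' K Ψ σ ∧
          Set.InjOn ((universeOf hHD hI hU h₃).pullC g 1) ((universeOf hHD hI hU h₃).Uiso Γ K Ψ σ : Set _) := by
  obtain ⟨g, -, hinj⟩ := universeOf_exists_mor_pms_pullC_injOn hHD hI hU h₃ hle h
  refine ⟨g, fun K Ψ σ => ⟨?_, ?_⟩⟩
  · rw [Submodule.map_le_iff_le_comap]
    intro ω hω
    exact Universe.pullC_mem_Uiso (universeOf_fact_pull_comp hHD hI hU h₃) g K Ψ σ hω
  · exact hinj.mono (Universe.Uiso_le_F_one (universeOf_fact_pull_hodge hHD hI hU h₃) Γ K Ψ σ)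

/-- **Supply is monotone in the level** (model universe): a non-zero class of `U_Ψ(Γ)_σ` yields a non-zero class of `U_Ψ(Γ')_σ`
for every `Γ' ≤ Γ` of an anisotropic hermitian space. [cite: Borel1997, §5.13–5.14]
[cite: BergeronMillsonMoeglin2016Balls, Introduction §1.1] -/
theorem universeOf_exists_mem_uiso_ne_zero_of_le (hHD : exists_isReal_hodgeModel) (hI : hodgePQ_independent_of_hodgeModel)
    (hU : BallQuotientUniformisedDatum) (h₃ : CMAbelianVarietyRealised) {L : CMField} {ι₁ : L →+* ℂ} {V : HermSpace3 L ι₁}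
    {Γ Γ' : Level V} (hle : Γ'.Γ ≤ Γ.Γ) (h : (pmsCode L ι₁ V Γ).IsAnisotropic) {K : CMField} {Ψ : CMType K} {σ : K →+* ℂ}
    (hω : ∃ ω ∈ (universeOf hHD hI hU h₃).Uiso Γ K Ψ σ, ω ≠ 0) :
    ∃ ω' ∈ (universeOf hHD hI hU h₃).Uiso Γ' K Ψ σ, ω' ≠ 0 := by
  obtain ⟨g, hg⟩ := universeOf_exists_mor_pms_uiso_mono hHD hI hU h₃ hle h
  obtain ⟨ω, hωU, hω0⟩ := hω
  obtain ⟨hmap, hinj⟩ := hg K Ψ σ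
  refine ⟨(universeOf hHD hI hU h₃).pullC g 1 ω, hmap (Submodule.mem_map_of_mem hωU), fun h0 => hω0 ?_⟩
  exact hinj hωU (Submodule.zero_mem _) (by rw [h0, map_zero])

/-- **B01-S ⇔ two independent one-type supplies**, on `universeOf hHD hI hU h₃` for ANY packaged uniformisation datum `hU`
(definition-free): `FaceSupply` holds iff every face datum has SOME level with a non-zero class of `U_{Ψ₀}(·)_{ι₁}` and SOME
level with a non-zero class of `U_{Ψ₁}(·)_{ι₁}` (common refinement `Γ₀ ⊓ Γ₁`, `Level.inf`; anisotropy from `6 ≤ [F:ℚ]`).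
[cite: Borel1997, §5.13–5.14] [cite: BergeronMillsonMoeglin2016Balls, Introduction §1.1] -/
theorem universeOf_faceSupply_iff_slotwise (hHD : exists_isReal_hodgeModel) (hI : hodgePQ_independent_of_hodgeModel)
    (hU : BallQuotientUniformisedDatum) (h₃ : CMAbelianVarietyRealised) :
    (universeOf hHD hI hU h₃).FaceSupply ↔
      ∀ (F : CMField), IsGalois ℚ F → 6 ≤ Module.finrank ℚ F →
        ∀ (f : Face F) (ι₁ : F →+* ℂ), f.Admissible ι₁ → ∀ V : HermSpace3 F ι₁,
          (∃ (Γ : Level V) (ω : (universeOf hHD hI hU h₃).CohC ((universeOf hHD hI hU h₃).pms F ι₁ V Γ) 1),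
              ω ∈ (universeOf hHD hI hU h₃).Uiso Γ F (f.psi 0) ι₁ ∧ ω ≠ 0) ∧
          (∃ (Γ : Level V) (ω : (universeOf hHD hI hU h₃).CohC ((universeOf hHD hI hU h₃).pms F ι₁ V Γ) 1),
              ω ∈ (universeOf hHD hI hU h₃).Uiso Γ F (f.psi 1) ι₁ ∧ ω ≠ 0) := by
  constructor
  · intro hS F hG h6 f ι₁ hι V
    obtain ⟨Γ, ω₀, ω₁, h₀, h₁', hne₀, hne₁⟩ := hS F hG h6 f ι₁ hι V
    exact ⟨⟨Γ, ω₀, h₀, hne₀⟩, ⟨Γ, ω₁, h₁', hne₁⟩⟩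
  · intro h F hG h6 f ι₁ hι V
    obtain ⟨⟨Γ₀, ω₀, h₀, hne₀⟩, ⟨Γ₁, ω₁, h₁', hne₁⟩⟩ := h F hG h6 f ι₁ hι V
    have hF : 2 < Module.finrank ℚ F := by omega
    obtain ⟨η₀, hη₀, hη₀ne⟩ := universeOf_exists_mem_uiso_ne_zero_of_le hHD hI hU h₃ (Γ := Γ₀) (Γ' := Γ₀ ⊓ Γ₁)
      (by rw [Level.inf_Γ]; exact inf_le_left) (isAnisotropic_pmsCode_of_two_lt hF Γ₀) ⟨ω₀, h₀, hne₀⟩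
    obtain ⟨η₁, hη₁, hη₁ne⟩ := universeOf_exists_mem_uiso_ne_zero_of_le hHD hI hU h₃ (Γ := Γ₁) (Γ' := Γ₀ ⊓ Γ₁)
      (by rw [Level.inf_Γ]; exact inf_le_right) (isAnisotropic_pmsCode_of_two_lt hF Γ₁) ⟨ω₁, h₁', hne₁⟩
    exact ⟨Γ₀ ⊓ Γ₁, η₀, η₁, hη₀, hη₁, hη₀ne, hη₁ne⟩

end Data

/-! ## §4  On the universe of record: `FaceSupply` ⇔ two independent one-type supplies -/

section EndState

/-- **The level covering of the universe of record is injective on `F¹H¹`** (`U = picardCMUniverse hHD hI h₁ h₃`; levels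
`Γ' ≤ Γ` in `GL₃(L)` of an anisotropic hermitian space). [cite: Borel1997, §5.13–5.14]
[cite: BergeronMillsonMoeglin2016Balls, Introduction §1.1] -/
theorem exists_mor_pms_pullC_injOn (hHD : exists_isReal_hodgeModel) (hI : hodgePQ_independent_of_hodgeModel)
    (h₁ : BallQuotientUniformised) (h₃ : CMAbelianVarietyRealised) {L : CMField} {ι₁ : L →+* ℂ} {V : HermSpace3 L ι₁}
    {Γ Γ' : Level V} (hle : Γ'.Γ ≤ Γ.Γ) (h : (pmsCode L ι₁ V Γ).IsAnisotropic) :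
    ∃ g : (picardCMUniverse hHD hI h₁ h₃).Mor ((picardCMUniverse hHD hI h₁ h₃).pms L ι₁ V Γ')
        ((picardCMUniverse hHD hI h₁ h₃).pms L ι₁ V Γ),
      Set.InjOn ((picardCMUniverse hHD hI h₁ h₃).pullC g 1)
        (((picardCMUniverse hHD hI h₁ h₃).hodge ((picardCMUniverse hHD hI h₁ h₃).pms L ι₁ V Γ) 1).F 1 : Set _) :=
  let ⟨g, _, hg⟩ := universeOf_exists_mor_pms_pullC_injOn hHD hI (ballQuotientUniformisedDatum_of h₁) h₃ hle h
  ⟨g, hg⟩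

/-- **Supply is monotone in the level** on the universe of record: for levels `Γ' ≤ Γ` of an anisotropic hermitian space there is
`g : U.pms L ι₁ V Γ' ⟶ U.pms L ι₁ V Γ` mapping every `U_Ψ(Γ)_σ` injectively into `U_Ψ(Γ')_σ`. [cite: Borel1997, §5.13–5.14]
[cite: BergeronMillsonMoeglin2016Balls, Introduction §1.1] -/
theorem exists_mor_pms_uiso_mono (hHD : exists_isReal_hodgeModel) (hI : hodgePQ_independent_of_hodgeModel)
    (h₁ : BallQuotientUniformised) (h₃ : CMAbelianVarietyRealised) {L : CMField} {ι₁ : L →+* ℂ} {V : HermSpace3 L ι₁}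
    {Γ Γ' : Level V} (hle : Γ'.Γ ≤ Γ.Γ) (h : (pmsCode L ι₁ V Γ).IsAnisotropic) :
    ∃ g : (picardCMUniverse hHD hI h₁ h₃).Mor ((picardCMUniverse hHD hI h₁ h₃).pms L ι₁ V Γ')
        ((picardCMUniverse hHD hI h₁ h₃).pms L ι₁ V Γ),
      ∀ (K : CMField) (Ψ : CMType K) (σ : K →+* ℂ),
        Submodule.map ((picardCMUniverse hHD hI h₁ h₃).pullC g 1) ((picardCMUniverse hHD hI h₁ h₃).Uiso Γ K Ψ σ) ≤
            (picardCMUniverse hHD hI h₁ h₃).Uiso Γ' K Ψ σ ∧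
          Set.InjOn ((picardCMUniverse hHD hI h₁ h₃).pullC g 1) ((picardCMUniverse hHD hI h₁ h₃).Uiso Γ K Ψ σ : Set _) :=
  universeOf_exists_mor_pms_uiso_mono hHD hI (ballQuotientUniformisedDatum_of h₁) h₃ hle h

/-- A non-zero class of `U_Ψ(Γ)_σ` yields one of `U_Ψ(Γ')_σ` for every `Γ' ≤ Γ` (universe of record, anisotropic hermitian
space). [cite: Borel1997, §5.13–5.14] [cite: BergeronMillsonMoeglin2016Balls, Introduction §1.1] -/
theorem exists_mem_uiso_ne_zero_of_le (hHD : exists_isReal_hodgeModel) (hI : hodgePQ_independent_of_hodgeModel)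
    (h₁ : BallQuotientUniformised) (h₃ : CMAbelianVarietyRealised) {L : CMField} {ι₁ : L →+* ℂ} {V : HermSpace3 L ι₁}
    {Γ Γ' : Level V} (hle : Γ'.Γ ≤ Γ.Γ) (h : (pmsCode L ι₁ V Γ).IsAnisotropic) {K : CMField} {Ψ : CMType K} {σ : K →+* ℂ}
    (hω : ∃ ω ∈ (picardCMUniverse hHD hI h₁ h₃).Uiso Γ K Ψ σ, ω ≠ 0) :
    ∃ ω' ∈ (picardCMUniverse hHD hI h₁ h₃).Uiso Γ' K Ψ σ, ω' ≠ 0 :=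
  universeOf_exists_mem_uiso_ne_zero_of_le hHD hI (ballQuotientUniformisedDatum_of h₁) h₃ hle h hω

/-- The same for every CM field of degree `> 2` (every face context, `6 ≤ [F:ℚ]`), anisotropy being automatic
(`Model.isAnisotropic_pmsCode_of_two_lt`). [cite: BergeronMillsonMoeglin2016Balls, Introduction §1.1] -/
theorem exists_mem_uiso_ne_zero_of_le_of_two_lt (hHD : exists_isReal_hodgeModel) (hI : hodgePQ_independent_of_hodgeModel)
    (h₁ : BallQuotientUniformised) (h₃ : CMAbelianVarietyRealised) {L : CMField} (hL : 2 < Module.finrank ℚ L) {ι₁ : L →+* ℂ}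
    {V : HermSpace3 L ι₁} {Γ Γ' : Level V} (hle : Γ'.Γ ≤ Γ.Γ) {K : CMField} {Ψ : CMType K} {σ : K →+* ℂ}
    (hω : ∃ ω ∈ (picardCMUniverse hHD hI h₁ h₃).Uiso Γ K Ψ σ, ω ≠ 0) :
    ∃ ω' ∈ (picardCMUniverse hHD hI h₁ h₃).Uiso Γ' K Ψ σ, ω' ≠ 0 :=
  exists_mem_uiso_ne_zero_of_le hHD hI h₁ h₃ hle (isAnisotropic_pmsCode_of_two_lt hL Γ) hω

/-- **B01-S ⇔ two independent one-type supplies** (universe of record `U = picardCMUniverse hHD hI h₁ h₃`, definition-free):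
`U.FaceSupply` holds iff, for every face datum `(F, f, ι₁, V)`, SOME level carries a non-zero class of `U_{Ψ₀}(·)_{ι₁}` and SOME
(possibly different) level carries a non-zero class of `U_{Ψ₁}(·)_{ι₁}` — the two are brought to the common refinement
`Γ₀ ⊓ Γ₁` (`Level.inf`) by `exists_mem_uiso_ne_zero_of_le_of_two_lt`. [cite: Borel1997, §5.13–5.14]
[cite: BergeronMillsonMoeglin2016Balls, Introduction §1.1] -/
theorem faceSupply_iff_slotwise (hHD : exists_isReal_hodgeModel) (hI : hodgePQ_independent_of_hodgeModel)
    (h₁ : BallQuotientUniformised) (h₃ : CMAbelianVarietyRealised) :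
    (picardCMUniverse hHD hI h₁ h₃).FaceSupply ↔
      ∀ (F : CMField), IsGalois ℚ F → 6 ≤ Module.finrank ℚ F →
        ∀ (f : Face F) (ι₁ : F →+* ℂ), f.Admissible ι₁ → ∀ V : HermSpace3 F ι₁,
          (∃ (Γ : Level V) (ω : (picardCMUniverse hHD hI h₁ h₃).CohC ((picardCMUniverse hHD hI h₁ h₃).pms F ι₁ V Γ) 1),
              ω ∈ (picardCMUniverse hHD hI h₁ h₃).Uiso Γ F (f.psi 0) ι₁ ∧ ω ≠ 0) ∧
          (∃ (Γ : Level V) (ω : (picardCMUniverse hHD hI h₁ h₃).CohC ((picardCMUniverse hHD hI h₁ h₃).pms F ι₁ V Γ) 1),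
              ω ∈ (picardCMUniverse hHD hI h₁ h₃).Uiso Γ F (f.psi 1) ι₁ ∧ ω ≠ 0) := by
  constructor
  · intro hS F hG h6 f ι₁ hι V
    obtain ⟨Γ, ω₀, ω₁, h₀, h₁', hne₀, hne₁⟩ := hS F hG h6 f ι₁ hι V
    exact ⟨⟨Γ, ω₀, h₀, hne₀⟩, ⟨Γ, ω₁, h₁', hne₁⟩⟩
  · intro h F hG h6 f ι₁ hι V
    obtain ⟨⟨Γ₀, ω₀, h₀, hne₀⟩, ⟨Γ₁, ω₁, h₁', hne₁⟩⟩ := h F hG h6 f ι₁ hι V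
    have hF : 2 < Module.finrank ℚ F := by omega
    obtain ⟨η₀, hη₀, hη₀ne⟩ := exists_mem_uiso_ne_zero_of_le_of_two_lt hHD hI h₁ h₃ hF (Γ := Γ₀) (Γ' := Γ₀ ⊓ Γ₁)
      (by rw [Level.inf_Γ]; exact inf_le_left) ⟨ω₀, h₀, hne₀⟩
    obtain ⟨η₁, hη₁, hη₁ne⟩ := exists_mem_uiso_ne_zero_of_le_of_two_lt hHD hI h₁ h₃ hF (Γ := Γ₁) (Γ' := Γ₀ ⊓ Γ₁)
      (by rw [Level.inf_Γ]; exact inf_le_right) ⟨ω₁, h₁', hne₁⟩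
    exact ⟨Γ₀ ⊓ Γ₁, η₀, η₁, hη₀, hη₁, hη₀ne, hη₁ne⟩

/-- **Cofinal form**: `U.FaceSupply` holds iff every face datum has a level `Γ` such that EVERY level `Γ' ≤ Γ` (in `GL₃(F)`)
carries non-zero classes of `U_{Ψ₀}(Γ')_{ι₁}` and `U_{Ψ₁}(Γ')_{ι₁}` (supply persists down the tower).
[cite: Borel1997, §5.13–5.14] [cite: BergeronMillsonMoeglin2016Balls, Introduction §1.1] -/
theorem faceSupply_iff_cofinal (hHD : exists_isReal_hodgeModel) (hI : hodgePQ_independent_of_hodgeModel)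
    (h₁ : BallQuotientUniformised) (h₃ : CMAbelianVarietyRealised) :
    (picardCMUniverse hHD hI h₁ h₃).FaceSupply ↔
      ∀ (F : CMField), IsGalois ℚ F → 6 ≤ Module.finrank ℚ F →
        ∀ (f : Face F) (ι₁ : F →+* ℂ), f.Admissible ι₁ → ∀ V : HermSpace3 F ι₁,
          ∃ Γ : Level V, ∀ Γ' : Level V, Γ'.Γ ≤ Γ.Γ →
            ∃ (ω₀ ω₁ : (picardCMUniverse hHD hI h₁ h₃).CohC ((picardCMUniverse hHD hI h₁ h₃).pms F ι₁ V Γ') 1),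
              ω₀ ∈ (picardCMUniverse hHD hI h₁ h₃).Uiso Γ' F (f.psi 0) ι₁ ∧
                ω₁ ∈ (picardCMUniverse hHD hI h₁ h₃).Uiso Γ' F (f.psi 1) ι₁ ∧ ω₀ ≠ 0 ∧ ω₁ ≠ 0 := by
  constructor
  · intro hS F hG h6 f ι₁ hι V
    obtain ⟨Γ, ω₀, ω₁, h₀, h₁', hne₀, hne₁⟩ := hS F hG h6 f ι₁ hι V
    have hF : 2 < Module.finrank ℚ F := by omega
    refine ⟨Γ, fun Γ' hle => ?_⟩
    obtain ⟨g, hg⟩ := exists_mor_pms_uiso_mono hHD hI h₁ h₃ hle (isAnisotropic_pmsCode_of_two_lt hF Γ)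
    obtain ⟨hmap₀, hinj₀⟩ := hg F (f.psi 0) ι₁
    obtain ⟨hmap₁, hinj₁⟩ := hg F (f.psi 1) ι₁
    refine ⟨(picardCMUniverse hHD hI h₁ h₃).pullC g 1 ω₀, (picardCMUniverse hHD hI h₁ h₃).pullC g 1 ω₁,
      hmap₀ (Submodule.mem_map_of_mem h₀), hmap₁ (Submodule.mem_map_of_mem h₁'), ?_, ?_⟩
    · exact fun h0 => hne₀ (hinj₀ h₀ (Submodule.zero_mem _) (by rw [h0, map_zero]))
    · exact fun h0 => hne₁ (hinj₁ h₁' (Submodule.zero_mem _) (by rw [h0, map_zero]))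
  · intro h F hG h6 f ι₁ hι V
    obtain ⟨Γ, hΓ⟩ := h F hG h6 f ι₁ hι V
    obtain ⟨ω₀, ω₁, h₀, h₁', hne₀, hne₁⟩ := hΓ Γ le_rfl
    exact ⟨Γ, ω₀, ω₁, h₀, h₁', hne₀, hne₁⟩

/-- The closed instance: the same equivalence for the model universe OF RECORD (all four data are tree theorems), whose
`FaceSupply` is the displayed leaf B01-S of `Model.perLFace_closed_of_supply_heckeWedge10_overlap`.
[cite: BergeronMillsonMoeglin2016Balls, Introduction §1.1] -/
theorem faceSupply_closed_iff_slotwise :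
    (picardCMUniverse exists_isReal_hodgeModel_holds hodgePQ_independent_of_hodgeModel_holds
        BallQuotient.ballQuotientUniformised_holds cmAbelianVarietyRealised_holds).FaceSupply ↔
      ∀ (F : CMField), IsGalois ℚ F → 6 ≤ Module.finrank ℚ F →
        ∀ (f : Face F) (ι₁ : F →+* ℂ), f.Admissible ι₁ → ∀ V : HermSpace3 F ι₁,
          (∃ (Γ : Level V) (ω : (picardCMUniverse exists_isReal_hodgeModel_holds hodgePQ_independent_of_hodgeModel_holds
              BallQuotient.ballQuotientUniformised_holds cmAbelianVarietyRealised_holds).CohC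
              ((picardCMUniverse exists_isReal_hodgeModel_holds hodgePQ_independent_of_hodgeModel_holds
                BallQuotient.ballQuotientUniformised_holds cmAbelianVarietyRealised_holds).pms F ι₁ V Γ) 1),
              ω ∈ (picardCMUniverse exists_isReal_hodgeModel_holds hodgePQ_independent_of_hodgeModel_holds
                BallQuotient.ballQuotientUniformised_holds cmAbelianVarietyRealised_holds).Uiso Γ F (f.psi 0) ι₁ ∧ ω ≠ 0) ∧
          (∃ (Γ : Level V) (ω : (picardCMUniverse exists_isReal_hodgeModel_holds hodgePQ_independent_of_hodgeModel_holds
              BallQuotient.ballQuotientUniformised_holds cmAbelianVarietyRealised_holds).CohC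
              ((picardCMUniverse exists_isReal_hodgeModel_holds hodgePQ_independent_of_hodgeModel_holds
                BallQuotient.ballQuotientUniformised_holds cmAbelianVarietyRealised_holds).pms F ι₁ V Γ) 1),
              ω ∈ (picardCMUniverse exists_isReal_hodgeModel_holds hodgePQ_independent_of_hodgeModel_holds
                BallQuotient.ballQuotientUniformised_holds cmAbelianVarietyRealised_holds).Uiso Γ F (f.psi 1) ι₁ ∧ ω ≠ 0) :=
  faceSupply_iff_slotwise _ _ _ _

end EndState

end Model

end Summit.HodgeConjecture.CorCM

end
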